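import Summits.BirchSwinnertonDyer.Rank1Residual.X11b.UnramifiedInertiaFixed
import HarnessLib

/-!
# Route `ClassRecordThree`, crux `HsiehDescentAtThree` (item stmt-BirchSwinnertonDyer-19108) — helper:
# a number field unramified above `p` is fixed by an OPEN subgroup `G_{ℚ_p(μ_m)}` of `Aut(ℚ̄_p/ℚ_p)`

Cell `bsd-stepL` (run/shared/lean/pub/bsd-stepL/), seat `bsd-stepL-desc3-p1` (D-0074 hand on item 19108),
`--supports stmt-BirchSwinnertonDyer-19108`.

The landed K5-B binder `hVRBU` of item 19108
(`Theorems/ClassRecordThreeHsiehDescentOfOpenReciprocity.lean`, p416145) asks for EXACT value reciprocity for every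
`τ ∈ Aut(ℚ̄₃/ℚ₃)` fixing the `m`-th roots of unity (some `m ≥ 1`, `3 ∤ m`) — the OPEN subgroup `G_{ℚ₃(μ_m)}` that the
printed Tate–Sen theorem (`Literature.NumberTheory.PAdicHodge.TateSenCharacterVanishing`) is stated for. The printed
CM theorems ([T1] BDP13 Thm. 5.5, [T2] Prop. 1.12 (1)) deliver exactness for `σ ∈ Aut(ℂ/F)` with `F ⊂ ℂ` a NUMBER FIELD
unramified above `3` (the Hilbert class field of `K`, times `ℚ(i)`). To pass from the archimedean shape to the
`3`-adic one needs: **for `F ⊂ ℂ` finite over `ℚ` with every prime above `p` unramified and `ι : ℚ̄_p ≃ ℂ`, there is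
`m ≥ 1`, `p ∤ m`, such that every `τ ∈ Aut(ℚ̄_p/ℚ_p)` fixing `μ_m` fixes `ι⁻¹(F)` pointwise** — the OPEN version of
x11b3's T6 (`X11b/UnramifiedInertiaFixed.lean`, `UnramifiedInertia.apply_symm_eq_of_mem`: the INERTIA version, `τ`
fixing ALL roots of unity of order prime to `p`). Classically: the closure of `ℚ_p·ι⁻¹(F)` is a finite unramified
extension of `ℚ_p`, hence `ℚ_p(μ_{p^f − 1})` for some `f`.

## Proof (road C of x11b3-p5, with step (a) replaced)

* (a′) `norm_apply_sub_lt_one_of_forall_pow_eq_one` — if `τ` fixes the `(q−1)`-th roots of unity (`q ≥ 2`) and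
  `y ∈ ℚ̄_p` has `‖y^q − y‖ < 1`, then `‖τ y − y‖ < 1`: `X^q − X` splits in `ℚ̄_p`, so
  `y^q − y = ∏_{a^q = a} (y − a)`; a product of norms `< 1` has a factor `‖y − a‖ < 1`; such an `a` is `0` or a
  `(q−1)`-th root of unity, so `τ a = a` and `‖τ y − y‖ = ‖τ(y − a) − (y − a)‖ ≤ ‖y − a‖ < 1` (`τ` is an
  isometry for the spectral norm, `spectralNorm_eq_of_equiv`). No residue field, no Hensel.
* (b) the Frobenius congruence `x^q ≡ x (mod p)` on `𝓞 F`, `q = p^f`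
  (`UnramifiedInertia.exists_pow_prime_pow_sub_mem_span`), giving `‖y^q − y‖ ≤ ‖p‖ < 1` on `ι⁻¹(𝓞 F)`;
* (c) the contraction over a `ℤ`-basis of `𝓞 F` VERBATIM as in `UnramifiedInertia.apply_symm_eq_of_mem`
  (`norm_add_pow_sub_pow_le`): `M ≤ max (‖p‖M) (M^q)` forces `M = 0`; fractions finish.

Main results: `apply_symm_eq_of_mem_of_forall_pow_eq_one` (explicit `m = p^f − 1` from a Frobenius exponent `f`)
and `exists_level_forall_fixing_rootsOfUnity_apply_symm_eq` (the `∃ m` form consumed by the K5-B glue).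
THEOREMS ONLY (no definition, no named fact, no `sorry`); every `p`. Adapted from `X11b/UnramifiedInertiaFixed.lean`.

References: J.-P. Serre, *Local Fields*, GTM 67, Ch. I §8, Ch. IV §4 Prop. 16 + Cor. 1–2 (finite unramified
extensions of a local field are generated by roots of unity of order prime to `p`) [`SerreLocalFields1979`];
J. Neukirch, *Algebraic Number Theory*, Ch. II (7.12)–(7.13) [`NeukirchANT1999`].
-/

noncomputable section

open scoped NumberField
open Polynomial
open Literature.NumberTheory.GaloisRepresentations
open Summit.BirchSwinnertonDyer.Rank1Residual.X11b

namespace Summit.BirchSwinnertonDyer.BirchSwinnertonDyer.Theorems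

namespace UnramifiedOpen

variable (p : ℕ) [Fact p.Prime]

/-! ### §1. (a′) An automorphism fixing `μ_{q−1}` moves Frobenius-congruent elements by less than `1` -/

/-- If the product of the factors `‖y − a‖` over a multiset is `< 1`, some factor is `< 1`
(induction on the multiset: if the head factor is `≥ 1` the tail product is `< 1`). [folklore] -/
theorem exists_mem_norm_sub_lt_one_of_prod_lt_one {y : PadicAlgCl p} :
    ∀ s : Multiset (PadicAlgCl p), (s.map fun a ↦ ‖y - a‖).prod < 1 → ∃ a ∈ s, ‖y - a‖ < 1 := by
  intro s
  induction s using Multiset.induction_on with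
  | empty => intro h; simp at h
  | cons a t ih =>
    intro h
    rw [Multiset.map_cons, Multiset.prod_cons] at h
    by_cases ha : ‖y - a‖ < 1
    · exact ⟨a, Multiset.mem_cons_self a t, ha⟩
    · have ha1 : 1 ≤ ‖y - a‖ := not_lt.mp ha
      have hrest0 : 0 ≤ (t.map fun a ↦ ‖y - a‖).prod :=
        Multiset.prod_nonneg fun r hr ↦ by
          obtain ⟨b, -, rfl⟩ := Multiset.mem_map.mp hr
          exact norm_nonneg _
      have hrest : (t.map fun a ↦ ‖y - a‖).prod < 1 :=
        lt_of_le_of_lt (le_mul_of_one_le_left hrest0 ha1) h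
      obtain ⟨b, hb, hb1⟩ := ih hrest
      exact ⟨b, Multiset.mem_cons_of_mem hb, hb1⟩

/-- **(a′)** If `τ ∈ Aut(ℚ̄_p/ℚ_p)` fixes every `(q−1)`-th root of unity (`q ≥ 2`) and `y ∈ ℚ̄_p` satisfies
`‖y^q − y‖ < 1`, then `‖τ y − y‖ < 1`. Indeed `X^q − X = ∏_{a^q = a}(X − a)` splits in `ℚ̄_p`, so some root `a`
(`a = 0` or `a^{q−1} = 1`, hence `τ a = a`) has `‖y − a‖ < 1`, and `τ` is an isometry of the spectral norm.
Classically: `y` is congruent to a Teichmüller representative. [folklore]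
[cite: SerreLocalFields1979, Ch. IV §4 Prop. 16] -/
theorem norm_apply_sub_lt_one_of_forall_pow_eq_one (τ : PadicAlgCl p ≃ₐ[ℚ_[p]] PadicAlgCl p) {q : ℕ}
    (hq : 2 ≤ q) (hτ : ∀ ζ : PadicAlgCl p, ζ ^ (q - 1) = 1 → τ ζ = ζ)
    {y : PadicAlgCl p} (hyq : ‖y ^ q - y‖ < 1) : ‖τ y - y‖ < 1 := by
  classical
  set P : (PadicAlgCl p)[X] := X ^ q - X with hP
  have hPmonic : P.Monic := monic_X_pow_sub (by rw [degree_X]; exact_mod_cast hq)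
  have hsplit : P.Splits := IsAlgClosed.splits P
  have heval : P.eval y = (P.roots.map (y - ·)).prod := hsplit.eval_eq_prod_roots_of_monic hPmonic y
  have hPy : P.eval y = y ^ q - y := by simp [hP]
  have hnorm : ‖y ^ q - y‖ = (P.roots.map fun a ↦ ‖y - a‖).prod := by
    rw [← hPy, heval]
    change normHom ((P.roots.map (y - ·)).prod) = _
    rw [map_multiset_prod, Multiset.map_map]
    rfl
  obtain ⟨a, ha, hya⟩ := exists_mem_norm_sub_lt_one_of_prod_lt_one p P.roots (hnorm ▸ hyq)
  -- `a` is a root of `X^q - X`: `a = 0` or `a^(q-1) = 1`, so `τ a = a`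
  have hroot : a ^ q - a = 0 := by
    have h := (mem_roots hPmonic.ne_zero).mp ha
    simpa [hP, IsRoot] using h
  have hτa : τ a = a := by
    rcases eq_or_ne a 0 with h0 | h0
    · rw [h0, map_zero]
    · apply hτ
      have h1 : a * (a ^ (q - 1) - 1) = 0 := by
        rw [mul_sub, mul_one, ← pow_succ', Nat.sub_add_cancel (by omega), hroot]
      rcases mul_eq_zero.mp h1 with h | h
      · exact absurd h h0
      · exact sub_eq_zero.mp h
  -- `τ` is an isometry
  have hiso : ∀ z : PadicAlgCl p, ‖τ z‖ = ‖z‖ := fun z ↦ by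
    rw [← PadicAlgCl.spectralNorm_eq, ← PadicAlgCl.spectralNorm_eq]
    exact (spectralNorm_eq_of_equiv τ z).symm
  have hrew : τ y - y = τ (y - a) - (y - a) := by rw [map_sub, hτa]; ring
  rw [hrew]
  calc ‖τ (y - a) - (y - a)‖ ≤ max ‖τ (y - a)‖ ‖y - a‖ := by
        rw [sub_eq_add_neg, ← norm_neg (y - a)]
        exact IsUltrametricDist.norm_add_le_max _ _
    _ = ‖y - a‖ := by rw [hiso, max_self]
    _ < 1 := hya

/-! ### §2. The contraction (road C of `X11b/UnramifiedInertiaFixed.lean`) with (a′) in place of inertia -/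

/-- **T6-OPEN with an explicit level.** Let `ι : ℚ̄_p ≃+* ℂ`, `F ⊂ ℂ` a subfield finite over `ℚ` in which every prime
`P ∋ p` has `P.ramificationIdx (𝓞 ℚ) = 1`, and let `f ≥ 1` be a Frobenius exponent of `𝓞 F`
(`x^{p^f} ≡ x (mod p)` for all `x ∈ 𝓞 F`). Then every `τ ∈ Aut(ℚ̄_p/ℚ_p)` fixing the `(p^f − 1)`-th roots of unity
fixes `ι⁻¹(F)` pointwise. Proof = road C of x11b3-p5 (`UnramifiedInertia.apply_symm_eq_of_mem`) with its step (a)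
replaced by `norm_apply_sub_lt_one_of_forall_pow_eq_one`: (b) `‖y^q − y‖ ≤ ‖p‖ < 1` on `ι⁻¹(𝓞 F)`; (c) with
`M = max ‖τ y_i − y_i‖` over a `ℤ`-basis, `M ≤ max (‖p‖ M) (M^q)` forces `M = 0`; fractions finish. Classically:
the closure of `ℚ_p·ι⁻¹(F)` is unramified of residue degree dividing `f`, hence inside `ℚ_p(μ_{p^f−1})`.
[cite: SerreLocalFields1979, Ch. IV §4 Prop. 16 and Cor. 1] [cite: NeukirchANT1999, Ch. II §7 (7.12)] -/
theorem apply_symm_eq_of_mem_of_forall_pow_eq_one [IsNonarchimedeanLocalField ℚ_[p]]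
    (ι : PadicAlgCl p ≃+* ℂ) (F : IntermediateField ℚ ℂ) (hFd : FiniteDimensional ℚ F)
    {f : ℕ} (hf : 0 < f) (hcong : ∀ x : 𝓞 F, x ^ p ^ f - x ∈ Ideal.span {((p : ℕ) : 𝓞 F)})
    (τ : PadicAlgCl p ≃ₐ[ℚ_[p]] PadicAlgCl p)
    (hτ : ∀ ζ : PadicAlgCl p, ζ ^ (p ^ f - 1) = 1 → τ ζ = ζ)
    (x : ℂ) (hx : x ∈ F) : τ (ι.symm x) = ι.symm x := by
  classical
  haveI : CharZero F := charZero_of_injective_algebraMap (algebraMap ℚ F).injective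
  haveI : NumberField F := { to_charZero := inferInstance, to_finiteDimensional := hFd }
  have hp : p.Prime := Fact.out
  -- norms of `ℤ` and of `p` in `ℚ̄_p` (the norm of `ℚ̄_p` extends that of `ℚ_p`)
  have hnormZ : ∀ n : ℤ, ‖(n : PadicAlgCl p)‖ ≤ 1 := fun n => by
    rw [← map_intCast (algebraMap ℚ_[p] (PadicAlgCl p)), ← PadicAlgCl.spectralNorm_eq,
      spectralNorm_extends]
    exact Padic.norm_int_le_one _
  have hnormp : ‖(p : PadicAlgCl p)‖ < 1 := by
    rw [← map_natCast (algebraMap ℚ_[p] (PadicAlgCl p)), ← PadicAlgCl.spectralNorm_eq,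
      spectralNorm_extends]
    exact Padic.norm_p_lt_one
  -- the embedding `e = ι⁻¹|_F : F → ℚ̄_p` and the derivation-like map `D = τ − 1`
  set e : F →+* PadicAlgCl p := ι.symm.toRingHom.comp (algebraMap F ℂ) with he_def
  have he : ∀ y : F, e y = ι.symm (y : ℂ) := fun y => rfl
  set D : PadicAlgCl p →+ PadicAlgCl p :=
    (τ : PadicAlgCl p →+ PadicAlgCl p) - AddMonoidHom.id _ with hD_def
  have hD : ∀ z, D z = τ z - z := fun z => rfl
  have hDmul : ∀ (n : PadicAlgCl p) (z : PadicAlgCl p), τ n = n → D (n * z) = n * D z := by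
    intro n z hn
    rw [hD, hD, map_mul, hn, mul_sub]
  -- integrality of `e b`, `b ∈ 𝓞 F`
  have hint : ∀ b : 𝓞 F, IsIntegral ℤ (e b) := fun b =>
    (NumberField.RingOfIntegers.isIntegral_coe b).map (e.toIntAlgHom)
  have hnorm : ∀ b : 𝓞 F, ‖e b‖ ≤ 1 := fun b => UnramifiedInertia.norm_le_one_of_isIntegral p (hint b)
  -- the Frobenius exponent
  set q := p ^ f with hq
  have hq2 : 2 ≤ q := by
    calc 2 ≤ p := hp.two_le
      _ = p ^ 1 := (pow_one p).symm
      _ ≤ p ^ f := Nat.pow_le_pow_right hp.pos hf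
  -- (a′)+(b): `‖D (e b)‖ < 1` for every `b ∈ 𝓞 F`
  have hlt : ∀ b : 𝓞 F, ‖D (e b)‖ < 1 := by
    intro b
    obtain ⟨w, hw⟩ := Ideal.mem_span_singleton'.mp (hcong b)
    have hyq : (e b) ^ q - e b = (p : PadicAlgCl p) * e w := by
      have h1 := congrArg (fun t : 𝓞 F => e t) hw
      simp only [map_mul, map_natCast, map_sub, map_pow] at h1
      linear_combination -h1
    have hyq' : ‖(e b) ^ q - e b‖ < 1 := by
      rw [hyq, norm_mul]
      calc ‖(p : PadicAlgCl p)‖ * ‖e w‖ ≤ ‖(p : PadicAlgCl p)‖ * 1 :=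
            mul_le_mul_of_nonneg_left (hnorm w) (norm_nonneg _)
        _ < 1 := by rw [mul_one]; exact hnormp
    rw [hD]
    exact norm_apply_sub_lt_one_of_forall_pow_eq_one p τ hq2 hτ hyq'
  -- an integral basis and the maximum `M`
  set B := NumberField.RingOfIntegers.basis F with hB
  haveI : Nonempty (Module.Free.ChooseBasisIndex ℤ (𝓞 F)) := B.index_nonempty
  have hne : (Finset.univ : Finset (Module.Free.ChooseBasisIndex ℤ (𝓞 F))).Nonempty :=
    Finset.univ_nonempty
  set M : ℝ := Finset.univ.sup' hne fun i => ‖D (e (B i))‖ with hM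
  have hMi : ∀ i, ‖D (e (B i))‖ ≤ M := fun i =>
    Finset.le_sup' (fun i => ‖D (e (B i))‖) (Finset.mem_univ i)
  have hM0 : 0 ≤ M := (norm_nonneg _).trans (hMi (Classical.arbitrary _))
  have hM1 : M < 1 := by
    rw [hM, Finset.sup'_lt_iff]
    exact fun i _ => hlt (B i)
  -- `‖D (e b)‖ ≤ M` for every `b ∈ 𝓞 F`
  have hDb : ∀ b : 𝓞 F, ‖D (e b)‖ ≤ M := by
    intro b
    have hb : e b = ∑ i, (B.repr b i : ℤ) • e (B i) := by
      conv_lhs => rw [← B.sum_repr b]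
      simp only [NumberField.RingOfIntegers.coe_eq_algebraMap, map_sum, map_zsmul]
    rw [hb, map_sum]
    refine IsUltrametricDist.norm_sum_le_of_forall_le_of_nonneg hM0 fun i _ => ?_
    rw [map_zsmul, zsmul_eq_mul, norm_mul]
    exact (mul_le_of_le_one_left (norm_nonneg _) (hnormZ _)).trans (hMi i)
  -- the key estimate `‖D (e (B i))‖ ≤ max (‖p‖ M) (M ^ q)`
  have hkey : ∀ i, ‖D (e (B i))‖ ≤ max (‖(p : PadicAlgCl p)‖ * M) (M ^ q) := by
    intro i
    obtain ⟨w, hw⟩ := Ideal.mem_span_singleton'.mp (hcong (B i))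
    -- `y = y^q - p·(e w)` with `y = e (B i)`
    set y := e (B i) with hy
    have hyq : y = y ^ q - (p : PadicAlgCl p) * e w := by
      have h1 := congrArg (fun t : 𝓞 F => e t) hw
      simp only [map_mul, map_natCast, map_sub, map_pow] at h1
      rw [← hy] at h1
      linear_combination h1
    have hpfix : τ (p : PadicAlgCl p) = p := map_natCast τ p
    have hτy : τ y = y + D y := by rw [hD, add_sub_cancel]
    have hDy : D y = ((y + D y) ^ q - y ^ q) - (p : PadicAlgCl p) * D (e w) := by
      have h2 : D y = D (y ^ q) - D ((p : PadicAlgCl p) * e w) := by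
        conv_lhs => rw [hyq]
        rw [map_sub]
      calc D y = D (y ^ q) - D ((p : PadicAlgCl p) * e w) := h2
        _ = ((τ y) ^ q - y ^ q) - (p : PadicAlgCl p) * D (e w) := by
          rw [hDmul _ _ hpfix, hD (y ^ q), map_pow]
        _ = ((y + D y) ^ q - y ^ q) - (p : PadicAlgCl p) * D (e w) := by rw [hτy]
    have hsub : ∀ a c : PadicAlgCl p, ‖a - c‖ ≤ max ‖a‖ ‖c‖ := fun a c => by
      rw [sub_eq_add_neg, ← norm_neg c]
      exact IsUltrametricDist.norm_add_le_max a (-c)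
    rw [hDy]
    refine (hsub _ _).trans (max_le ?_ ?_)
    · refine (UnramifiedInertia.norm_add_pow_sub_pow_le p f (hnorm (B i)) ((hlt (B i)).le)).trans ?_
      refine max_le_max ?_ ?_
      · exact mul_le_mul_of_nonneg_left (hMi i) (norm_nonneg _)
      · exact pow_le_pow_left₀ (norm_nonneg _) (hMi i) _
    · refine le_max_of_le_left ?_
      rw [norm_mul]
      exact mul_le_mul_of_nonneg_left (hDb w) (norm_nonneg _)
  -- hence `M = 0`
  have hMle : M ≤ max (‖(p : PadicAlgCl p)‖ * M) (M ^ q) := by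
    rw [hM, Finset.sup'_le_iff]
    exact fun i _ => hkey i
  have hMz : M = 0 := by
    by_contra hne0
    have hMpos : 0 < M := lt_of_le_of_ne hM0 (Ne.symm hne0)
    have h1 : ‖(p : PadicAlgCl p)‖ * M < M :=
      mul_lt_of_lt_one_left hMpos hnormp
    have h2 : M ^ q < M := by
      calc M ^ q ≤ M ^ 2 := pow_le_pow_of_le_one hM0 hM1.le hq2
        _ = M * M := sq M
        _ < M * 1 := mul_lt_mul_of_pos_left hM1 hMpos
        _ = M := mul_one M
    exact absurd hMle (not_le.mpr (max_lt h1 h2))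
  -- so `τ` fixes `e (𝓞 F)` …
  have hfix : ∀ b : 𝓞 F, τ (e b) = e b := by
    intro b
    have h := hDb b
    rw [hMz] at h
    have h0 : D (e b) = 0 := norm_le_zero_iff.mp h
    rwa [hD, sub_eq_zero] at h0
  -- … and `e F` (fractions)
  obtain ⟨a, b, hb, hab⟩ := IsFractionRing.div_surjective (A := 𝓞 F) (⟨x, hx⟩ : F)
  have hxe : ι.symm x = e a / e b := by
    rw [← map_div₀ e, hab]; rfl
  rw [hxe, map_div₀, hfix a, hfix b]

/-! ### §3. The `∃ m` export -/

/-- **T6-OPEN (binder-free `∃ m` form, every `p`).** For every `ι : ℚ̄_p ≃+* ℂ` and every `F : IntermediateField ℚ ℂ`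
finite over `ℚ` with `P.ramificationIdx (𝓞 ℚ) = 1` at every prime `P ∋ p`, there is `m ≥ 1` with `p ∤ m` such that
every `τ : PadicAlgCl p ≃ₐ[ℚ_[p]] PadicAlgCl p` fixing the `m`-th roots of unity (`∀ ζ, ζ^m = 1 → τ ζ = ζ` — the
shape of the K5-B binder of p416145) satisfies `τ (ι.symm x) = ι.symm x` for all `x ∈ F`. Take `m = p^f − 1` for a
Frobenius exponent `f` of `𝓞 F` (`UnramifiedInertia.exists_pow_prime_pow_sub_mem_span`); the tree's local-field
structure on `ℚ_[p]` is supplied by `Padic.isNonarchimedeanLocalField_holds p`. Classically: the closure of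
`ℚ_p·ι⁻¹(F)` lies in the unramified extension `ℚ_p(μ_{p^f−1})`.
[cite: SerreLocalFields1979, Ch. IV §4 Prop. 16 and Cor. 1] [cite: NeukirchANT1999, Ch. II §7 (7.12)] -/
theorem exists_level_forall_fixing_rootsOfUnity_apply_symm_eq
    (ι : PadicAlgCl p ≃+* ℂ) (F : IntermediateField ℚ ℂ) (hFd : FiniteDimensional ℚ F)
    (hunr : ∀ P : Ideal (𝓞 F), P.IsPrime → ((p : ℕ) : 𝓞 F) ∈ P → P.ramificationIdx (𝓞 ℚ) = 1) :
    ∃ m : ℕ, 0 < m ∧ ¬ p ∣ m ∧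
      ∀ τ : PadicAlgCl p ≃ₐ[ℚ_[p]] PadicAlgCl p, (∀ ζ : PadicAlgCl p, ζ ^ m = 1 → τ ζ = ζ) →
        ∀ x : ℂ, x ∈ F → τ (ι.symm x) = ι.symm x := by
  haveI := Padic.isNonarchimedeanLocalField_holds p
  haveI : CharZero F := charZero_of_injective_algebraMap (algebraMap ℚ F).injective
  haveI : NumberField F := { to_charZero := inferInstance, to_finiteDimensional := hFd }
  have hp : p.Prime := Fact.out
  obtain ⟨f, hf, hcong⟩ := UnramifiedInertia.exists_pow_prime_pow_sub_mem_span p F hunr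
  have hq2 : 2 ≤ p ^ f := by
    calc 2 ≤ p := hp.two_le
      _ = p ^ 1 := (pow_one p).symm
      _ ≤ p ^ f := Nat.pow_le_pow_right hp.pos hf
  refine ⟨p ^ f - 1, by omega, ?_, fun τ hτ x hx ↦
    apply_symm_eq_of_mem_of_forall_pow_eq_one p ι F hFd hf hcong τ hτ x hx⟩
  -- `p ∤ p^f - 1`
  intro hdvd
  have h1 : p ∣ p ^ f := dvd_pow_self p hf.ne'
  have h2 : p ∣ p ^ f - (p ^ f - 1) := Nat.dvd_sub h1 hdvd
  rw [Nat.sub_sub_self (by omega)] at h2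
  exact hp.one_lt.ne' (Nat.dvd_one.mp h2)

end UnramifiedOpen

end Summit.BirchSwinnertonDyer.BirchSwinnertonDyer.Theorems

end
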